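import Mathlib
import Summits.CriticalPhenomena.SAWScalingLimit.Theses.SAWLeftRightFKG
import Literature.Probability.RandomPlanarGeometry.EdgeFugacitySAW

/-!
# Sketch — crux-ideate `stmt-CriticalPhenomena-11232` (`LeftRightFKG`), ideator 3, round 1

First lemmas of ideator 3's idea cards.  They must ELABORATE; nothing here is claimed proved
(`sorry` marks the stubs a crux-plan would register).

* Card `compound-transfer-cone` (§2): the corner covariance of an instance is the `2 × 2`
  CONTINGENCY DETERMINANT `w(A∩B)w(Aᶜ∩Bᶜ) − w(A∩Bᶜ)w(Aᶜ∩B)`; whenever the four masses are matrix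
  elements `αᵢᵀ (T₁ ⋯ T_N) βⱼ` of one product of (column-to-column transfer) matrices, the
  determinant is ONE matrix element of the product of SECOND COMPOUND matrices
  `Λ²T₁ ⋯ Λ²T_N` between the wedges `α₀ ∧ α₁` and `β₀ ∧ β₁` (Cauchy–Binet functoriality,
  `cmp2_mul`, `det_two_eq_wedge`), so a common INVARIANT CONE for the `Λ²T_k` containing `β₀ ∧ β₁`
  and dual-positive on `α₀ ∧ α₁` certifies the sign (`det_nonneg_of_coneCertificate`).  The line:
  `ConeLineXc → CornerXc → LeftRightFKG` (the last implication is card `corner-localisation`'s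
  reduction, cited, not re-derived).
* Card `harris-pocket-dynamics` (§3): Harris' theorem on a finite poset — a stochastically monotone
  (Massey) rate matrix whose jumps join only COMPARABLE states and which fixes `w` makes `w`
  positively associated (`harris_PA`) — and the existence statement it would need
  (`HarrisLine → LeftRightFKG`).  [The LP toys of this session decide existence on small boxes; see
  the card / negative notes for the verdict.]
-/

open MeasureTheory Matrix
open Literature.Probability.LatticeModels Literature.Probability.RandomPlanarGeometry
open scoped Classical BigOperators

namespace Summit.CriticalPhenomena.SAWScalingLimit.Cruxes.LeftRightFKG.Ideator3

/-! ## §1 Common vocabulary over the edge-weighted carrier (as in ideator 1's sketch, own namespace) -/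

/-- Sites enclosed by the closed boundary walk `C` (winding `≠ 0` of its unit-mesh polyline). -/
noncomputable def encl {c : Site 2} (C : (zdGraph 2).Walk c c) : Set (Site 2) :=
  {v | Literature.Topology.PlaneTopology.wind
        (fun t : ℝ => Set.IccExtend zero_le_one (C.toCurve (meshPoint 1)) t - meshPoint 1 v) ≠ 0}

/-- The crux's left–right order, verbatim at mesh `1`: the lens loop winds non-negatively. -/
noncomputable def lrLE {a b : Site 2} (γ₁ γ₂ : (zdGraph 2).Walk a b) : Prop :=
  ∀ z : ℂ, 0 ≤ Literature.Topology.PlaneTopology.wind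
    (fun t : ℝ => Set.IccExtend zero_le_one ((γ₁.append γ₂.reverse).toCurve (meshPoint 1)) t - z)

/-- Real-valued mass of a set of chords under the edge-weighted SAW measure `∏ y`. -/
noncomputable def wR (y : Site 2 → Site 2 → ℝ) (S : Set (Site 2)) (a b : Site 2)
    (A : Set (SAW.RestrictedSAW (zdGraph 2) S a b)) : ℝ :=
  (SAW.edgeFugacityWeight (zdGraph 2) y S a b A).toReal

/-- Up-set of chords for the left–right order. -/
def IsUpSet {S : Set (Site 2)} {a b : Site 2} (A : Set (SAW.RestrictedSAW (zdGraph 2) S a b)) : Prop :=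
  ∀ γ₁ γ₂, lrLE γ₁.walk γ₂.walk → γ₁ ∈ A → γ₂ ∈ A

/-- `A` is decided by the first step. -/
def FirstStepEvent {S : Set (Site 2)} {a b : Site 2} (A : Set (SAW.RestrictedSAW (zdGraph 2) S a b)) :
    Prop :=
  ∀ γ₁ γ₂, γ₁.walk.getVert 1 = γ₂.walk.getVert 1 → (γ₁ ∈ A ↔ γ₂ ∈ A)

/-- `B` is decided by the last step. -/
def LastStepEvent {S : Set (Site 2)} {a b : Site 2} (B : Set (SAW.RestrictedSAW (zdGraph 2) S a b)) :
    Prop :=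
  ∀ γ₁ γ₂, γ₁.walk.getVert (γ₁.walk.length - 1) = γ₂.walk.getVert (γ₂.walk.length - 1) →
    (γ₁ ∈ B ↔ γ₂ ∈ B)

/-- The capped edge-weighted class: symmetric weights `0 ≤ y ≤ x_c`. -/
def CappedWeights (y : Site 2 → Site 2 → ℝ) : Prop :=
  (∀ u v, y u v = y v u) ∧ ∀ u v, 0 ≤ y u v ∧ y u v ≤ SAW.criticalFugacity

/-- `CornerXc` (card `kesten-loop-towers` / `corner-localisation`, restated here so that this file
is self-contained): positive correlation of the two marked-point (corner) up-events for every
instance of the capped edge-weighted class. -/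
def CornerXc : Prop :=
  ∀ (c a b a' b' : Site 2) (C : (zdGraph 2).Walk c c) (y : Site 2 → Site 2 → ℝ),
    a' ∈ C.support → b' ∈ C.support → (zdGraph 2).Adj a a' → (zdGraph 2).Adj b b' →
    CappedWeights y →
    ∀ A B : Set (SAW.RestrictedSAW (zdGraph 2) (encl C) a b),
      IsUpSet A → IsUpSet B → FirstStepEvent A → LastStepEvent B →
      wR y (encl C) a b A * wR y (encl C) a b B ≤
        wR y (encl C) a b Set.univ * wR y (encl C) a b (A ∩ B)

/-! ## §2 Card `compound-transfer-cone` -/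

section Compound

variable {ι : Type*} [Fintype ι] [DecidableEq ι] [LinearOrder ι]

/-- Increasing pairs `p.1 < p.2` of indices: the basis of `Λ²`. -/
abbrev Pair (ι : Type*) [LinearOrder ι] : Type _ := {p : ι × ι // p.1 < p.2}

/-- Second (multiplicative) compound matrix: `(Λ²T)_{(p,q),(r,s)} = T_{pr}T_{qs} − T_{ps}T_{qr}`. -/
def cmp2 (T : Matrix ι ι ℝ) : Matrix (Pair ι) (Pair ι) ℝ :=
  fun P Q => T P.1.1 Q.1.1 * T P.1.2 Q.1.2 - T P.1.1 Q.1.2 * T P.1.2 Q.1.1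

/-- Wedge of two vectors: `(u ∧ v)_{(p,q)} = u_p v_q − u_q v_p`. -/
def wedge (u v : ι → ℝ) : Pair ι → ℝ :=
  fun P => u P.1.1 * v P.1.2 - u P.1.2 * v P.1.1

/-- Cauchy–Binet = functoriality of `Λ²`: `Λ²(TS) = Λ²T · Λ²S`. -/
theorem cmp2_mul (T S : Matrix ι ι ℝ) : cmp2 (T * S) = cmp2 T * cmp2 S := by
  sorry

/-- The `2 × 2` determinant of bilinear matrix elements is a single matrix element of `Λ²T`
between wedges (Cauchy–Binet with row/column vectors). -/
theorem det_two_eq_wedge (T : Matrix ι ι ℝ) (α₀ α₁ β₀ β₁ : ι → ℝ) :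
    (α₀ ⬝ᵥ T.mulVec β₀) * (α₁ ⬝ᵥ T.mulVec β₁) - (α₀ ⬝ᵥ T.mulVec β₁) * (α₁ ⬝ᵥ T.mulVec β₀)
      = wedge α₀ α₁ ⬝ᵥ (cmp2 T).mulVec (wedge β₀ β₁) := by
  sorry

/-- A cone: closed under addition and non-negative scaling, containing `0`. -/
def IsCone {κ : Type*} (K : Set (κ → ℝ)) : Prop :=
  (0 : κ → ℝ) ∈ K ∧ (∀ u ∈ K, ∀ v ∈ K, u + v ∈ K) ∧ ∀ (t : ℝ), 0 ≤ t → ∀ u ∈ K, t • u ∈ K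

end Compound

/-- CONE CERTIFICATE for a real `2 × 2` matrix `Z`: its entries are matrix elements
`αᵢᵀ (T₀ ⋯ T_{N-1}) βⱼ` of one product of `n × n` matrices, and some cone of `Λ²ℝⁿ` is invariant
under every `Λ²T_k`, contains `β₀ ∧ β₁`, and pairs non-negatively with `α₀ ∧ α₁`. -/
def ConeCertificate (Z : Matrix (Fin 2) (Fin 2) ℝ) : Prop :=
  ∃ (n N : ℕ) (T : Fin N → Matrix (Fin n) (Fin n) ℝ) (α β : Fin 2 → Fin n → ℝ)
    (K : Set (Pair (Fin n) → ℝ)),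
    (∀ i j, Z i j = α i ⬝ᵥ ((List.ofFn T).prod.mulVec (β j))) ∧ IsCone K ∧
    (∀ k, ∀ v ∈ K, (cmp2 (T k)).mulVec v ∈ K) ∧ wedge (β 0) (β 1) ∈ K ∧
    (∀ v ∈ K, 0 ≤ wedge (α 0) (α 1) ⬝ᵥ v)

/-- A cone certificate forces `det Z ≥ 0` (induction on `N` with `cmp2_mul`, `det_two_eq_wedge`). -/
theorem det_nonneg_of_coneCertificate {Z : Matrix (Fin 2) (Fin 2) ℝ} (h : ConeCertificate Z) :
    0 ≤ Z 0 0 * Z 1 1 - Z 0 1 * Z 1 0 := by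
  sorry

/-- The contingency matrix of two events `A`, `B` of chords (rows: `A`, `Aᶜ`; columns: `B`, `Bᶜ`). -/
noncomputable def contingency (y : Site 2 → Site 2 → ℝ) (S : Set (Site 2)) (a b : Site 2)
    (A B : Set (SAW.RestrictedSAW (zdGraph 2) S a b)) : Matrix (Fin 2) (Fin 2) ℝ :=
  !![wR y S a b (A ∩ B), wR y S a b (A ∩ Bᶜ); wR y S a b (Aᶜ ∩ B), wR y S a b (Aᶜ ∩ Bᶜ)]

/-- The contingency identity: `w(A∩B)·w(all) − w(A)·w(B) = det (contingency A B)` (finite masses). -/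
theorem wR_inter_mul_univ_sub (y : Site 2 → Site 2 → ℝ) (S : Set (Site 2)) [Finite S] (a b : Site 2)
    (A B : Set (SAW.RestrictedSAW (zdGraph 2) S a b)) :
    wR y S a b (A ∩ B) * wR y S a b Set.univ - wR y S a b A * wR y S a b B =
      (contingency y S a b A B) 0 0 * (contingency y S a b A B) 1 1 -
        (contingency y S a b A B) 0 1 * (contingency y S a b A B) 1 0 := by
  sorry

/-- THE LINE (hypothesis to be discharged by transfer-matrix constructions): every corner
contingency matrix of the capped edge-weighted class carries a cone certificate. -/
def ConeLineXc : Prop :=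
  ∀ (c a b a' b' : Site 2) (C : (zdGraph 2).Walk c c) (y : Site 2 → Site 2 → ℝ),
    a' ∈ C.support → b' ∈ C.support → (zdGraph 2).Adj a a' → (zdGraph 2).Adj b b' →
    CappedWeights y →
    ∀ A B : Set (SAW.RestrictedSAW (zdGraph 2) (encl C) a b),
      IsUpSet A → IsUpSet B → FirstStepEvent A → LastStepEvent B →
      ConeCertificate (contingency y (encl C) a b A B)

/-- Stub 1 of the line: cone certificates give the corner inequality (pure algebra:
`det_nonneg_of_coneCertificate` + `wR_inter_mul_univ_sub`; finiteness of `encl C`). -/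
theorem cornerXc_of_coneLine (h : ConeLineXc) : CornerXc := by
  sorry

/-- Stub 2 of the line = card `corner-localisation`'s reduction (`cornerXc_imp_crux` in ideator 1's
sketch): corner positivity over the capped edge-weighted class implies the crux (`y ≡ x_c`). -/
theorem crux_of_cornerXc (h : CornerXc) :
    Summit.CriticalPhenomena.SAWScalingLimit.Theses.SAWLeftRightFKG.LeftRightFKG := by
  sorry

/-! ## §3 Card `harris-pocket-dynamics` — Harris' theorem on a finite poset and the line it opens -/

section Harris

variable {Γ : Type*} [Fintype Γ]

/-- Positive association of a weight `w ≥ 0` on a finite carrier for a relation `le`, in the crux's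
event form `w(A)·w(B) ≤ w(all)·w(A∩B)` for `le`-up-closed `A`, `B`. -/
def PAOf (le : Γ → Γ → Prop) (w : Γ → ℝ) : Prop :=
  ∀ A B : Finset Γ, (∀ γ₁ γ₂, le γ₁ γ₂ → γ₁ ∈ A → γ₂ ∈ A) → (∀ γ₁ γ₂, le γ₁ γ₂ → γ₁ ∈ B → γ₂ ∈ B) →
    (∑ γ ∈ A, w γ) * (∑ γ ∈ B, w γ) ≤ (∑ γ, w γ) * (∑ γ ∈ A ∩ B, w γ)

/-- Rate matrix (generator): non-negative off-diagonal entries, zero row sums. -/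
def IsRateMatrix (Q : Γ → Γ → ℝ) : Prop :=
  (∀ η ζ, η ≠ ζ → 0 ≤ Q η ζ) ∧ ∀ η, ∑ ζ, Q η ζ = 0

/-- Harris' condition (b): jumps only between comparable states. -/
def ComparableJumps (le : Γ → Γ → Prop) (Q : Γ → Γ → ℝ) : Prop :=
  ∀ η ζ, η ≠ ζ → Q η ζ ≠ 0 → (le η ζ ∨ le ζ η)

/-- Massey's characterisation of stochastic monotonicity of the generated semigroup: for `η ≤ ζ`,
rates INTO up-sets avoiding `ζ` increase and rates into down-sets avoiding `η` decrease. -/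
def MasseyMonotone (le : Γ → Γ → Prop) (Q : Γ → Γ → ℝ) : Prop :=
  ∀ η ζ, le η ζ → η ≠ ζ →
    (∀ U : Finset Γ, (∀ s t, le s t → s ∈ U → t ∈ U) → ζ ∉ U → ∑ s ∈ U, Q η s ≤ ∑ s ∈ U, Q ζ s) ∧
    (∀ D : Finset Γ, (∀ s t, le s t → t ∈ D → s ∈ D) → η ∉ D → ∑ s ∈ D, Q ζ s ≤ ∑ s ∈ D, Q η s)

/-- `w` is stationary for `Q`. -/
def IsStationary (w : Γ → ℝ) (Q : Γ → Γ → ℝ) : Prop :=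
  ∀ ζ, ∑ η, w η * Q η ζ = 0

/-- Irreducibility of the jump graph. -/
def IsIrreducible (Q : Γ → Γ → ℝ) : Prop :=
  ∀ η ζ, Relation.ReflTransGen (fun s t => s ≠ t ∧ Q s t ≠ 0) η ζ

/-- HARRIS 1977 (Ann. Probab. 5, 451–454; Liggett, IPS, Thm II.2.14) on a finite partially ordered
set: a monotone generator with comparable jumps preserves positive association, hence its unique
stationary law is positively associated.  [cite: Harris1977; Liggett1985 Thm II.2.14] -/
theorem harris_PA (le : Γ → Γ → Prop) [IsPartialOrder Γ le] (w : Γ → ℝ) (hw : ∀ γ, 0 ≤ w γ)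
    (Q : Γ → Γ → ℝ) (hQ : IsRateMatrix Q) (hcomp : ComparableJumps le Q)
    (hmono : MasseyMonotone le Q) (hstat : IsStationary w Q) (hirr : IsIrreducible Q) :
    PAOf le w := by
  sorry

end Harris

/-- THE HARRIS LINE (existence statement, per instance of the crux's own class at `y ≡ x_c`): a
Harris dynamics for the chord poset.  The session's LP toys test it on the smallest boxes. -/
def HarrisLine : Prop :=
  ∀ (c a b a' b' : Site 2) (C : (zdGraph 2).Walk c c),
    a' ∈ C.support → b' ∈ C.support → (zdGraph 2).Adj a a' → (zdGraph 2).Adj b b' →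
    ∀ [Fintype (SAW.RestrictedSAW (zdGraph 2) (encl C) a b)],
    ∃ Q : SAW.RestrictedSAW (zdGraph 2) (encl C) a b → SAW.RestrictedSAW (zdGraph 2) (encl C) a b → ℝ,
      IsRateMatrix Q ∧ ComparableJumps (fun γ₁ γ₂ => lrLE γ₁.walk γ₂.walk) Q ∧
      MasseyMonotone (fun γ₁ γ₂ => lrLE γ₁.walk γ₂.walk) Q ∧
      IsStationary (fun γ => SAW.criticalFugacity ^ γ.walk.length) Q ∧ IsIrreducible Q

/-- The Harris line would close the crux (Harris' theorem per instance + carrier identification at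
mesh `1`; `δ` is immaterial by scaling). -/
theorem crux_of_harrisLine (h : HarrisLine) :
    Summit.CriticalPhenomena.SAWScalingLimit.Theses.SAWLeftRightFKG.LeftRightFKG := by
  sorry

end Summit.CriticalPhenomena.SAWScalingLimit.Cruxes.LeftRightFKG.Ideator3
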